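import Literature.NumberTheory.EllipticCurves.BurungaleSkinner2023.RankOneTwistsPAdicRegulator
import HarnessLib

/-!
# Burungale–Skinner 2023 — monotonicity of "positive proportion of quadratic characters" (PROVED)

Bookkeeping for the conclusions of Thms. 2.9 / 3.2 / 3.5 of A. Burungale, C. Skinner, Proc. AMS
Ser. B 10 (2023) (tree `OddQuadraticCharPosProportion`, `EvenQuadraticCharPosProportion`,
`RankOneTwistsPAdicRegulator.lean`): a positive lower density of discriminants satisfying `P` gives
a positive lower density for every weaker property `Q` (pointwise `P d → Q d`), with the same
constant. So a consumer interested in ONE clause of `TwistConclusion` (e.g. only the non-degeneracy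
of the `p`-adic height, or only `rank = ord_{s=1} L = 1`) reads it off Thm. 2.9 by name
(`thm29_posProportion_padicHeightNondegenerate`, `thm29_posProportion_rank_eq_one`). Theorems only.

References: [BurungaleSkinner2023] Thm. 2.9 (p. 21), Thms. 3.2, 3.5 (pp. 25, 27).
-/

noncomputable section

open scoped Classical

open Filter WeierstrassCurve Literature.NumberTheory.EllipticCurves
  Literature.NumberTheory.EllipticCurves.Rank1Residual

namespace Literature.NumberTheory.EllipticCurves.BurungaleSkinner2023

/-! ### Monotonicity of the counting predicates -/

/-- Counting sets of integers in a ball are finite. [folklore] -/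
private theorem finite_setOf_natAbs_le (X : ℕ) (R : ℤ → Prop) :
    {d : ℤ | R d ∧ d.natAbs ≤ X}.Finite := by
  refine (Set.finite_Icc (-(X : ℤ)) X).subset ?_
  intro d hd
  simp only [Set.mem_setOf_eq] at hd
  simp only [Set.mem_Icc]
  omega

/-- **Monotonicity of "positive proportion of odd quadratic characters".** If `P d → Q d` for every
`d`, a positive lower density for `P` is one for `Q` (same constant; the numerator only grows).
[cite: BurungaleSkinner2023, Thm. 2.9 (p. 21)] -/
theorem OddQuadraticCharPosProportion.mono {P Q : ℤ → Prop} (hPQ : ∀ d, P d → Q d)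
    (h : OddQuadraticCharPosProportion P) : OddQuadraticCharPosProportion Q := by
  obtain ⟨c, hc, hev⟩ := h
  refine ⟨c, hc, hev.mono fun X hX => hX.trans ?_⟩
  have hfin : {d : ℤ | IsOddQuadraticCharDiscr d ∧ d.natAbs ≤ X ∧ Q d}.Finite := by
    refine (finite_setOf_natAbs_le X IsOddQuadraticCharDiscr).subset ?_
    intro d hd
    exact ⟨hd.1, hd.2.1⟩
  have hsub : {d : ℤ | IsOddQuadraticCharDiscr d ∧ d.natAbs ≤ X ∧ P d} ⊆
      {d : ℤ | IsOddQuadraticCharDiscr d ∧ d.natAbs ≤ X ∧ Q d} :=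
    fun d hd => ⟨hd.1, hd.2.1, hPQ d hd.2.2⟩
  exact_mod_cast Nat.card_mono hfin hsub

/-- **Monotonicity of "positive proportion of even quadratic characters".**
[cite: BurungaleSkinner2023, Thm. 3.5 (p. 27)] -/
theorem EvenQuadraticCharPosProportion.mono {P Q : ℤ → Prop} (hPQ : ∀ d, P d → Q d)
    (h : EvenQuadraticCharPosProportion P) : EvenQuadraticCharPosProportion Q := by
  obtain ⟨c, hc, hev⟩ := h
  refine ⟨c, hc, hev.mono fun X hX => hX.trans ?_⟩
  have hfin : {d : ℤ | IsEvenQuadraticCharDiscr d ∧ d.natAbs ≤ X ∧ Q d}.Finite := by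
    refine (finite_setOf_natAbs_le X IsEvenQuadraticCharDiscr).subset ?_
    intro d hd
    exact ⟨hd.1, hd.2.1⟩
  have hsub : {d : ℤ | IsEvenQuadraticCharDiscr d ∧ d.natAbs ≤ X ∧ P d} ⊆
      {d : ℤ | IsEvenQuadraticCharDiscr d ∧ d.natAbs ≤ X ∧ Q d} :=
    fun d hd => ⟨hd.1, hd.2.1, hPQ d hd.2.2⟩
  exact_mod_cast Nat.card_mono hfin hsub

/-! ### Thm. 2.9 read clause by clause -/

/-- **Thm. 2.9, non-degeneracy clause alone:** under the hypotheses of Thm. 2.9, for a positive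
proportion of discriminants `d` of imaginary quadratic fields, the `3`-adic height pairing on EVERY
globally minimal model of the twist `E^{(d)}` is non-degenerate (`PAdicHeightNondegenerate`).
From the named fact by monotonicity. [cite: BurungaleSkinner2023, Thm. 2.9 (p. 21, second bullet)] -/
theorem thm29_posProportion_padicHeightNondegenerate
    (h : thm29_posProportion_twists_rankOne_nondegenerate)
    (W : WeierstrassCurve ℚ) [W.IsElliptic] [W.IsGloballyMinimal]
    (Φ : AddSubgroup (geomTorsion W (3 : ℤ))) (ℓ₀ : ℕ) [Fact ℓ₀.Prime]
    (hN : ¬ 3 ∣ W.conductorNorm ℤ) (hΦ : IsRationalLine W 3 Φ)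
    (hpar : (LineEven W 3 Φ ∧ LineUnramifiedAt W 3 Φ) ∨ (LineOdd W 3 Φ ∧ ¬ LineUnramifiedAt W 3 Φ))
    (hℓ₀ : ℓ₀ ∣ W.conductorNorm ℤ) (hr : numPrimesAbove 3 ℓ₀ = 1) (hA : Addv W ℓ₀ → ℓ₀ % 3 = 2) :
    OddQuadraticCharPosProportion fun d ↦
      ∀ (W' : WeierstrassCurve ℚ) [W'.IsElliptic] [W'.IsGloballyMinimal] (C : VariableChange ℚ),
        C • W.quadraticTwist (d : ℚ) = W' → PAdicHeightNondegenerate W' 3 :=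
  OddQuadraticCharPosProportion.mono (fun _ hd W' _ _ C hC => (hd.2.2 W' C hC).2)
    (h W Φ ℓ₀ hN hΦ hpar hℓ₀ hr hA)

/-- **Thm. 2.9, rank clause alone:** for a positive proportion of `d`, `rank E^{(d)}(ℚ) =
ord_{s=1} L(E^{(d)}, s) = 1`. [cite: BurungaleSkinner2023, Thm. 2.9 (p. 21, first bullet)] -/
theorem thm29_posProportion_rank_eq_one (h : thm29_posProportion_twists_rankOne_nondegenerate)
    (W : WeierstrassCurve ℚ) [W.IsElliptic] [W.IsGloballyMinimal]
    (Φ : AddSubgroup (geomTorsion W (3 : ℤ))) (ℓ₀ : ℕ) [Fact ℓ₀.Prime]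
    (hN : ¬ 3 ∣ W.conductorNorm ℤ) (hΦ : IsRationalLine W 3 Φ)
    (hpar : (LineEven W 3 Φ ∧ LineUnramifiedAt W 3 Φ) ∨ (LineOdd W 3 Φ ∧ ¬ LineUnramifiedAt W 3 Φ))
    (hℓ₀ : ℓ₀ ∣ W.conductorNorm ℤ) (hr : numPrimesAbove 3 ℓ₀ = 1) (hA : Addv W ℓ₀ → ℓ₀ % 3 = 2) :
    OddQuadraticCharPosProportion fun d ↦
      (W.quadraticTwist (d : ℚ)).mordellWeilRank = 1 ∧ (W.quadraticTwist (d : ℚ)).analyticRank = 1 :=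
  OddQuadraticCharPosProportion.mono (fun _ hd => ⟨hd.1, hd.2.1⟩) (h W Φ ℓ₀ hN hΦ hpar hℓ₀ hr hA)

end Literature.NumberTheory.EllipticCurves.BurungaleSkinner2023

end
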